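import Mathlib

/-!
# Rank-certificate formats for the four-row pencil span (crux `ValuativeGCT.ValuativeFlip`)

Helper lemmas for stub `stub_fourRowPencilRank` of line `four-row-count`
(crux stmt-ValiantsHypothesis-12624, `Cruxes/ValuativeFlip/Lines/four_row_count.lean`), more precisely
for its `m`-free form, hypothesis `H` of `fourRowPencilRank_of_pencilCertificate`
(`Theorems/ValuativeGCTValuativeFlipFourRowTransfer.lean`):
`2⌊6n/5⌋² + ⌊6n/5⌋ + 2 ≤ finrank ℂ (span ℂ (range fun (t, ij) => X t * (∂_ij per_n)(M·X)))`.
Every proof of such a lower bound `D ≤ finrank (span (range f))` for an explicit finite family `f`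
of polynomials is a CERTIFICATE of one of the following shapes, which this file provides once and
for all (wall-breaker axis k2 "tables / small cases certified", `Cruxes/ValuativeFlip/AXIS-k2g1.md`):

* `prc_linearIndependent_of_det_ne_zero`, `prc_card_le_finrank_span_of_coeff_det_ne_zero`:
  a nonsingular `D × D` minor of the matrix of values of linear functionals (coefficients of
  monomials) on a sub-family ⇒ `D ≤ finrank (span (range f))`;
* `prc_det_intCast_ne_zero_of_det_zmod_ne_zero`: an INTEGER minor that is nonsingular modulo a
  prime (a finite computation) is nonsingular over `ℂ` — the format of the computed tables
  (kit job j019010: ranks mod `2⁶¹-1` are certified lower bounds for the rank over `ℂ`);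
* `prc_linearIndependent_of_triangular`, `prc_linearIndependent_of_degree_injective`,
  `prc_card_le_finrank_span_of_degree_injOn`: unitriangular certificates — functionals `φ_i` with
  `φ_i(v_i) ≠ 0` and `φ_i(v_j) = 0` whenever `deg j < deg i`; in particular polynomials with pairwise
  distinct leading monomials for a monomial order are linearly independent;
* `prc_det_ne_zero_of_tightMinor`, `prc_det_ne_zero_of_uniqueMinTransversal`,
  `prc_exists_eval_det_ne_zero`: the "ε-power specialisation with a unique lowest-order transversal"
  named in the stub's docstring — for a matrix over `K[X]` and potentials `u, v` with
  `ord_X (P a b) ≥ u a + v b`, nonsingularity of the matrix of coefficients at the tight level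
  `u a + v b` (e.g. diagonal tight pattern) forces `det P ≠ 0`, and then some numeric specialisation
  `X ↦ x₀` keeps the minor nonsingular (so a symbolic pencil with weights `X^{w(t,k)}` yields the
  numeric pencil `M : Fin n × Fin n → Fin 4 → ℂ` that `H` asks for).

All statements are elementary linear algebra; nothing here is specific to permanents.
[folklore; Cox–Little–O'Shea, Ideals, Varieties, and Algorithms, Ch. 2 §2 (monomial orders);
Theorems/ValuativeGCTValuativeFlipEvalRankLowerBoundK3.lean (the same determinant trick for
orbit-closure multiplicities)]
-/

set_option linter.dupNamespace false

namespace Summit.ValiantsHypothesis.ValiantsHypothesis.Theorems.ValuativeFlip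

open scoped BigOperators Matrix Polynomial

section Triangular

/-- **Unitriangular certificate ⇒ linear independence.**  If `deg : ι → β` ranks the family
injectively and linear functionals `φ i` satisfy `φ i (v i) ≠ 0` and `φ i (v j) = 0` whenever
`deg j < deg i`, then `v` is linearly independent (apply `φ a` to a relation at the index `a` of
maximal rank).  [folklore] -/
theorem prc_linearIndependent_of_triangular {R M ι : Type*} [CommRing R] [IsDomain R]
    [AddCommGroup M] [Module R M] {β : Type*} [LinearOrder β] (v : ι → M)
    (φ : ι → M →ₗ[R] R) (deg : ι → β) (hinj : Function.Injective deg)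
    (hdiag : ∀ i, φ i (v i) ≠ 0) (hlow : ∀ i j, deg j < deg i → φ i (v j) = 0) :
    LinearIndependent R v := by
  classical
  rw [linearIndependent_iff']
  intro s
  induction s using Finset.induction_on_max_value deg with
  | empty => intro g _ i hi; exact absurd hi (Finset.notMem_empty i)
  | insert a s has hmax ih =>
    intro g hg i hi
    rw [Finset.sum_insert has] at hg
    have hga : g a = 0 := by
      have h1 := congrArg (φ a) hg
      rw [map_add, map_sum, map_zero, map_smul] at h1
      have h2 : ∑ x ∈ s, φ a (g x • v x) = 0 := Finset.sum_eq_zero fun x hx => by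
        have hne : x ≠ a := fun h => has (h ▸ hx)
        have hlt : deg x < deg a := lt_of_le_of_ne (hmax x hx) fun h => hne (hinj h)
        rw [map_smul, hlow a x hlt, smul_zero]
      rw [h2, add_zero, smul_eq_mul] at h1
      exact (mul_eq_zero.mp h1).resolve_right (hdiag a)
    rw [hga, zero_smul, zero_add] at hg
    rcases Finset.mem_insert.mp hi with rfl | hi'
    · exact hga
    · exact ih g hg i hi'

/-- **Distinct leading monomials ⇒ linear independence.**  For a monomial order `m` on `σ`, nonzero
polynomials whose `m`-leading monomials are pairwise distinct are linearly independent
(coefficient extraction at the leading monomial is a unitriangular certificate).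
[Cox–Little–O'Shea Ch. 2 §2; folklore] -/
theorem prc_linearIndependent_of_degree_injective {R ι : Type*} [CommRing R] [IsDomain R]
    {σ : Type*} (m : MonomialOrder σ) (f : ι → MvPolynomial σ R) (hf : ∀ i, f i ≠ 0)
    (hinj : Function.Injective fun i => m.toSyn (m.degree (f i))) :
    LinearIndependent R f := by
  refine prc_linearIndependent_of_triangular f (fun i => MvPolynomial.lcoeff R (m.degree (f i)))
    (fun i => m.toSyn (m.degree (f i))) hinj ?_ ?_
  · intro i
    rw [MvPolynomial.lcoeff_apply]
    exact m.leadingCoeff_ne_zero_iff.mpr (hf i)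
  · intro i j hij
    rw [MvPolynomial.lcoeff_apply]
    exact m.coeff_eq_zero_of_lt hij

/-- **Determinant certificate ⇒ linear independence.**  If the square matrix of values
`(φ a (v b))_{a,b}` of linear functionals on the family is nonsingular, the family is linearly
independent. [folklore] -/
theorem prc_linearIndependent_of_det_ne_zero {R M : Type*} [CommRing R] [IsDomain R]
    [AddCommGroup M] [Module R M] {κ : Type*} [Fintype κ] [DecidableEq κ]
    (v : κ → M) (φ : κ → M →ₗ[R] R)
    (h : (Matrix.of fun a b : κ => φ a (v b)).det ≠ 0) : LinearIndependent R v := by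
  rw [Fintype.linearIndependent_iff]
  intro g hg
  have hvec : (Matrix.of fun a b : κ => φ a (v b)) *ᵥ g = 0 := by
    funext a
    have h1 := congrArg (φ a) hg
    rw [map_sum, map_zero] at h1
    simp only [map_smul, smul_eq_mul] at h1
    rw [Pi.zero_apply, ← h1, Matrix.mulVec, dotProduct]
    refine Finset.sum_congr rfl fun b _ => ?_
    rw [Matrix.of_apply, mul_comm]
  exact congr_fun (Matrix.eq_zero_of_mulVec_eq_zero h hvec)

end Triangular

section Finrank

/-- A linearly independent SUB-family `v ∘ e` of a finite family `v` bounds the dimension of the span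
of the whole family from below: `card κ ≤ finrank (span (range v))`. [folklore] -/
theorem prc_card_le_finrank_span_of_linearIndependent_comp {K V ι : Type*} [Field K]
    [AddCommGroup V] [Module K V] [Fintype ι] {κ : Type*} [Fintype κ]
    (v : ι → V) (e : κ → ι) (h : LinearIndependent K (v ∘ e)) :
    Fintype.card κ ≤ Module.finrank K ↥(Submodule.span K (Set.range v)) := by
  have h1 : Fintype.card κ ≤ Module.finrank K ↥(Submodule.span K (Set.range (v ∘ e))) :=
    linearIndependent_iff_card_le_finrank_span.mp h
  haveI : Module.Finite K ↥(Submodule.span K (Set.range v)) :=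
    Module.Finite.span_of_finite K (Set.finite_range v)
  exact h1.trans (Submodule.finrank_mono (Submodule.span_mono (Set.range_comp_subset_range e v)))

/-- **Coefficient-minor certificate** (the format of every table row): for a finite family `f` of
polynomials, a sub-family `f ∘ e` indexed by `κ` and monomials `mon a`, if the `κ × κ` matrix of
coefficients `coeff (mon a) (f (e b))` is nonsingular then `card κ ≤ finrank (span (range f))`.
[folklore] -/
theorem prc_card_le_finrank_span_of_coeff_det_ne_zero {K ι σ κ : Type*} [Field K] [Fintype ι]
    [Fintype κ] [DecidableEq κ] (f : ι → MvPolynomial σ K) (e : κ → ι) (mon : κ → (σ →₀ ℕ))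
    (h : (Matrix.of fun a b : κ => (f (e b)).coeff (mon a)).det ≠ 0) :
    Fintype.card κ ≤ Module.finrank K ↥(Submodule.span K (Set.range f)) := by
  refine prc_card_le_finrank_span_of_linearIndependent_comp f e ?_
  refine prc_linearIndependent_of_det_ne_zero (f ∘ e) (fun a => MvPolynomial.lcoeff K (mon a)) ?_
  simpa only [Function.comp, MvPolynomial.lcoeff_apply] using h

/-- **Leading-monomial certificate**: if the polynomials `f i`, `i ∈ S`, are nonzero with pairwise
distinct `m`-leading monomials, then `S.card ≤ finrank (span (range f))`.
[Cox–Little–O'Shea Ch. 2 §2; folklore] -/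
theorem prc_card_le_finrank_span_of_degree_injOn {K ι σ : Type*} [Field K] [Fintype ι]
    (m : MonomialOrder σ) (f : ι → MvPolynomial σ K) (S : Finset ι) (hf : ∀ i ∈ S, f i ≠ 0)
    (hinj : Set.InjOn (fun i => m.toSyn (m.degree (f i))) S) :
    S.card ≤ Module.finrank K ↥(Submodule.span K (Set.range f)) := by
  classical
  have h := prc_card_le_finrank_span_of_linearIndependent_comp f (fun i : S => (i : ι))
    (prc_linearIndependent_of_degree_injective m (f ∘ fun i : S => (i : ι))
      (fun i => hf i i.2) (fun i j hij => Subtype.ext (hinj i.2 j.2 hij)))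
  simpa only [Fintype.card_coe] using h

/-- **Modular certificates are certificates.**  An integer matrix whose reduction modulo `p` is
nonsingular is nonsingular over every ring of characteristic zero (e.g. `ℂ`): `det` commutes with
ring maps and `ℤ → S` is injective.  This is why every rank computed modulo a prime in the tables
is a certified lower bound for the rank over `ℂ`. [folklore] -/
theorem prc_det_intCast_ne_zero_of_det_zmod_ne_zero {κ : Type*} [Fintype κ] [DecidableEq κ]
    (p : ℕ) (A : Matrix κ κ ℤ) (h : (A.map (Int.castRingHom (ZMod p))).det ≠ 0)
    (S : Type*) [CommRing S] [CharZero S] : (A.map (Int.castRingHom S)).det ≠ 0 := by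
  have hA : A.det ≠ 0 := by
    intro h0
    apply h
    rw [← RingHom.mapMatrix_apply, ← RingHom.map_det, h0, map_zero]
  rw [← RingHom.mapMatrix_apply, ← RingHom.map_det, eq_intCast]
  exact Int.cast_ne_zero.mpr hA

end Finrank

section Valuation

/-- **Tight-minor certificate** ("lowest-order terms decide").  Let `P` be a square matrix over
`K[X]` and `u, v` potentials with `ord_X (P a b) ≥ u a + v b` for all `a, b` (all coefficients below
that level vanish).  If the matrix of coefficients AT the tight level, `coeff (u a + v b) (P a b)`, is
nonsingular, then `det P ≠ 0`: writing `P a b = X^(u a + v b) · N a b` gives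
`det P = X^(Σu+Σv) · det N` and `det N (0) = det (tight matrix) ≠ 0`. [folklore (tropical /
valuative rank bounds)] -/
theorem prc_det_ne_zero_of_tightMinor {K : Type*} [Field K] {κ : Type*} [Fintype κ]
    [DecidableEq κ] (P : Matrix κ κ K[X]) (u v : κ → ℕ)
    (hlow : ∀ a b, ∀ d < u a + v b, (P a b).coeff d = 0)
    (htight : (Matrix.of fun a b : κ => (P a b).coeff (u a + v b)).det ≠ 0) : P.det ≠ 0 := by
  -- divide out the potentials
  set N : Matrix κ κ K[X] := Matrix.of fun a b => P a b /ₘ (Polynomial.X ^ (u a + v b)) with hN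
  have hfac : ∀ a b, P a b = Polynomial.X ^ (u a + v b) * N a b := by
    intro a b
    have hmonic : (Polynomial.X ^ (u a + v b) : K[X]).Monic := Polynomial.monic_X_pow _
    have hdvd : Polynomial.X ^ (u a + v b) ∣ P a b := Polynomial.X_pow_dvd_iff.mpr (hlow a b)
    have hmod : P a b %ₘ Polynomial.X ^ (u a + v b) = 0 :=
      (Polynomial.modByMonic_eq_zero_iff_dvd hmonic).mpr hdvd
    have h := Polynomial.modByMonic_add_div (P a b) (Polynomial.X ^ (u a + v b))
    rw [hmod, zero_add] at h
    rw [hN, Matrix.of_apply]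
    exact h.symm
  set N' : Matrix κ κ K[X] := Matrix.of fun a b => (Polynomial.X : K[X]) ^ v b * N a b with hN'
  have hP : P = Matrix.of fun a b => (Polynomial.X : K[X]) ^ u a * N' a b := by
    ext a b
    rw [Matrix.of_apply, hN', Matrix.of_apply, ← mul_assoc, ← pow_add, hfac a b]
  have hdet : P.det = (∏ a, (Polynomial.X : K[X]) ^ u a) *
      ((∏ b, (Polynomial.X : K[X]) ^ v b) * N.det) := by
    rw [hP, Matrix.det_mul_column (fun a => (Polynomial.X : K[X]) ^ u a) N', hN',
      Matrix.det_mul_row (fun b => (Polynomial.X : K[X]) ^ v b) N]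
  -- the constant term of `N` is the tight matrix
  have hN0 : ∀ a b, (N a b).coeff 0 = (P a b).coeff (u a + v b) := by
    intro a b
    rw [hfac a b, Polynomial.coeff_X_pow_mul', if_pos le_rfl, Nat.sub_self]
  have hNdet : N.det ≠ 0 := by
    intro h0
    apply htight
    have h1 : (Polynomial.evalRingHom (0 : K)) N.det = 0 := by rw [h0, map_zero]
    rw [RingHom.map_det, RingHom.mapMatrix_apply] at h1
    rw [← h1]
    congr 1
    ext a b
    rw [Matrix.of_apply, Matrix.map_apply, Polynomial.coe_evalRingHom,
      ← Polynomial.coeff_zero_eq_eval_zero, hN0]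
  rw [hdet]
  refine mul_ne_zero (Finset.prod_ne_zero_iff.mpr fun a _ => pow_ne_zero _ Polynomial.X_ne_zero)
    (mul_ne_zero (Finset.prod_ne_zero_iff.mpr fun b _ => pow_ne_zero _ Polynomial.X_ne_zero) hNdet)

/-- **Unique lowest-order transversal ⇒ nonsingular** (the certificate shape named in the docstring
of `stub_fourRowPencilRank`): if `ord_X (P a b) ≥ u a + v b` everywhere, with EQUALITY exactly on the
diagonal (nonzero tight coefficient on the diagonal, zero tight coefficient off it), then
`det P ≠ 0`. [folklore] -/
theorem prc_det_ne_zero_of_uniqueMinTransversal {K κ : Type*} [Field K] [Fintype κ]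
    [DecidableEq κ] (P : Matrix κ κ K[X]) (u v : κ → ℕ)
    (hlow : ∀ a b, ∀ d < u a + v b, (P a b).coeff d = 0)
    (hdiag : ∀ a, (P a a).coeff (u a + v a) ≠ 0)
    (hoff : ∀ a b, a ≠ b → (P a b).coeff (u a + v b) = 0) : P.det ≠ 0 := by
  refine prc_det_ne_zero_of_tightMinor P u v hlow ?_
  have hd : (Matrix.of fun a b : κ => (P a b).coeff (u a + v b)) =
      Matrix.diagonal fun a => (P a a).coeff (u a + v a) := by
    ext a b
    rw [Matrix.of_apply, Matrix.diagonal_apply]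
    split_ifs with hab
    · subst hab; rfl
    · exact hoff a b hab
  rw [hd, Matrix.det_diagonal]
  exact Finset.prod_ne_zero_iff.mpr fun a _ => hdiag a

/-- **Symbolic ⇒ numeric.**  Over an infinite field a matrix over `K[X]` with nonzero determinant
has a numeric specialisation `X ↦ x₀` with nonzero determinant (a nonzero polynomial has a
non-root).  With the two lemmas above: a pencil with weights `X^{w(t,k)}` carrying a tight-minor
certificate of size `D` specialises to a numeric pencil whose span has `finrank ≥ D`. [folklore] -/
theorem prc_exists_eval_det_ne_zero {K κ : Type*} [Field K] [Infinite K] [Fintype κ]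
    [DecidableEq κ] (P : Matrix κ κ K[X]) (h : P.det ≠ 0) :
    ∃ x : K, (P.map (Polynomial.eval x)).det ≠ 0 := by
  by_contra hall
  push Not at hall
  apply h
  refine Polynomial.zero_of_eval_zero _ fun x => ?_
  have h1 := hall x
  rwa [← Polynomial.coe_evalRingHom, ← RingHom.mapMatrix_apply, ← RingHom.map_det] at h1

end Valuation

end Summit.ValiantsHypothesis.ValiantsHypothesis.Theorems.ValuativeFlip
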